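import Literature.Barriers.Parity.SiegelZeroQuadraticPolynomialsProgressions
import Literature.Barriers.Parity.SiegelZeroQuadraticPolynomialsErrorSums
import HarnessLib

/-!
# Granville–Mollin's Theorem 4: the error sum of (6.2) over `N/y⁴ < q' ≤ N/16`
# (the weights `min{1/ϱ_d, (log y/log(N/q'))²}`)

Topic `Literature/Barriers/Parity`, summation layer of the proof of
`Literature.Barriers.Parity.GranvilleMollin2000_thm4` (Granville–Mollin, *Rabinowitsch revisited*,
Acta Arith. 96 (2000), Theorem 4, §6B: "We note that, for `N/y ≤ q ≤ N`, we have
`∏_{N/q<p≤y}(1 − ω(p)/p)⁻¹ ≪ min{1/ϱ_d, (log y/log(N/q))²}`. Now `∑_{x<p<2x} ω(p)/p ≪ 1/log(d^η)`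
for `x > d^C`, by (5.5). Combining these last two bounds to estimate the error term in (6.2),
after some calculation, gives …"). Everything is PROVED; no definition is introduced.
Companion of `SiegelZeroQuadraticPolynomialsRangesA.lean` (ranges `q' > N/16`, `q' ≤ q^{9.5}`,
`q^{9.5} < q' ≤ N/2^{M+1}`); here `2^M ≤ y⁴` (`M log 2 ≤ 4 log y`) and the range is the `M − 3`
dyadic blocks `N/2^{M+1} < q' ≤ N/16`, on which the progression `n ≡ r (mod q')` of length
`X = N/q' ∈ [2^m, 2^{m+1})`, `4 ≤ m ≤ M`, is sieved up to `z = min(y, X^{1/4})`: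
`V(z) ≤ min{1, Kω (4 log y/(m log 2))² V(y)}` by the dimension-`2` condition, and
`log² z ≤ log² X/16`.

* `sum_rangeIIb_le` — `∑_{N/2^{M+1} < q' ≤ N/16} ∑_r T(q', r) ≤
  (1 + Cω) N · 4K_c (3 √(Kω V(y) (4 log y/log 2)²) + 1) + (e⁸/16) · 1536 K_c N`.
* `two_pow_sub_three_mul` — `2^{M−3} · N/2^{M+1} = N/16`.

[cite: GranvilleMollin2000, §6B (6.2) and the two displays after it]
-/

noncomputable section

open Finset Real Polynomial
open Literature.NumberTheory.Sieve

namespace Literature.Barriers.Parity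

/-- `2^{M−3} · (N/2^{M+1}) = N/16` for `M ≥ 3`. [folklore] -/
theorem two_pow_sub_three_mul {M : ℕ} (hM : 3 ≤ M) (N : ℝ) :
    (2 : ℝ) ^ (M - 3) * (N / 2 ^ (M + 1)) = N / 16 := by
  have h : (2 : ℝ) ^ (M + 1) = (2 : ℝ) ^ (M - 3) * 2 ^ 4 := by
    rw [← pow_add]; congr 1; omega
  rw [h]
  have h0 : (2 : ℝ) ^ (M - 3) ≠ 0 := pow_ne_zero _ two_ne_zero
  field_simp
  norm_num

/-- `16^{1/4} = 2`. [folklore] -/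
theorem sixteen_rpow_quarter : (16 : ℝ) ^ ((1 : ℝ) / 4) = 2 := by
  rw [show (16 : ℝ) = 2 ^ (4 : ℝ) by norm_num, ← Real.rpow_mul (by norm_num)]
  norm_num

/-- Splitting `∑ ω(q') [C (N/q') w(q') + √(N/q') log²(N/q') R]`. [folklore] -/
theorem sum_omega_mul_split' {d : ℤ} (S : Finset ℕ) (N R C : ℝ) (w : ℕ → ℝ) :
    ∑ q' ∈ S, (polyRootCountMod ![rabinowitschPoly d] q' : ℝ) *
        (C * (N / q') * w q' + Real.sqrt (N / q') * Real.log (N / q') ^ 2 * R) =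
      C * N * ∑ q' ∈ S, (polyRootCountMod ![rabinowitschPoly d] q' : ℝ) / q' * w q' +
        R * ∑ q' ∈ S, (polyRootCountMod ![rabinowitschPoly d] q' : ℝ) *
          (Real.sqrt (N / q') * Real.log (N / q') ^ 2) := by
  rw [mul_sum, mul_sum, ← sum_add_distrib]
  refine sum_congr rfl fun q' _ => ?_
  ring

/-- **The sieve weight on a dyadic scale**: for `q ≡ 3 (mod 8)`, `y ≥ 2`, `M log 2 ≤ 4 log y`,
`4 ≤ m ≤ M` and `X ≥ 2^m`, with `z = min(y, X^{1/4})`: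
`V(z) ≤ min{1, Kω (4 log y/(m log 2))² V(y)}`. [cite: GranvilleMollin2000, §6B] -/
theorem densityProduct_min_le {d : ℤ} {q : ℕ} (hdq : d = -(q : ℤ)) (hq8 : q % 8 = 3) {y X : ℝ}
    (hy : 2 ≤ y) {M m : ℕ} (hMy : (M : ℝ) * Real.log 2 ≤ 4 * Real.log y) (hm4 : 4 ≤ m)
    (hmM : m ≤ M) (hX : (2 : ℝ) ^ m ≤ X) :
    ∏ p ∈ Nat.primesBelow ⌈min y (X ^ ((1 : ℝ) / 4))⌉₊,
        (1 - (polyRootCountMod ![rabinowitschPoly d] p : ℝ) / p) ≤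
      min 1 ((2 * Real.exp (17 + 12 / Real.log 2)) * (4 * Real.log y / (m * Real.log 2)) ^ 2 *
        ∏ p ∈ Nat.primesBelow ⌈y⌉₊, (1 - (polyRootCountMod ![rabinowitschPoly d] p : ℝ) / p)) := by
  obtain ⟨h2, hle⟩ := rabinowitsch_omega_hyps hdq hq8
  have hlog2 : 0 < Real.log 2 := Real.log_pos one_lt_two
  have hm0 : (0 : ℝ) < m := by exact_mod_cast (show 0 < m by omega)
  have hM0 : (0 : ℝ) < M := by exact_mod_cast (show 0 < M by omega)
  have hmlog : 0 < (m : ℝ) * Real.log 2 := mul_pos hm0 hlog2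
  have hlogy : 0 < Real.log y := Real.log_pos (by linarith)
  have h16 : (16 : ℝ) ≤ X := by
    have : (2 : ℝ) ^ 4 ≤ (2 : ℝ) ^ m := pow_le_pow_right₀ (by norm_num) hm4
    linarith [show (2 : ℝ) ^ 4 = 16 by norm_num]
  have hX0 : 0 < X := by linarith
  have hX4 : 2 ≤ X ^ ((1 : ℝ) / 4) := by
    rw [← sixteen_rpow_quarter]
    exact Real.rpow_le_rpow (by norm_num) h16 (by norm_num)
  have hlogX : (m : ℝ) * Real.log 2 ≤ Real.log X := by
    have := Real.log_le_log (by positivity) hX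
    rwa [Real.log_pow] at this
  set V := ∏ p ∈ Nat.primesBelow ⌈y⌉₊, (1 - (polyRootCountMod ![rabinowitschPoly d] p : ℝ) / p) with hV
  have hV0 : 0 ≤ V := (prod_one_sub_rootCount_pos h2 hle y).le
  have hKω1 : (1 : ℝ) ≤ 2 * Real.exp (17 + 12 / Real.log 2) := by
    have := Real.one_le_exp (show (0 : ℝ) ≤ 17 + 12 / Real.log 2 by positivity)
    linarith
  refine le_min (prod_one_sub_rootCount_le_one _ _) ?_
  -- the ratio bound `t = 4 log y/(m log 2) ≥ 1`
  have ht1 : 1 ≤ 4 * Real.log y / (m * Real.log 2) := by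
    rw [le_div_iff₀ hmlog, one_mul]
    have : (m : ℝ) * Real.log 2 ≤ M * Real.log 2 :=
      mul_le_mul_of_nonneg_right (by exact_mod_cast hmM) hlog2.le
    linarith
  by_cases hcase : X ^ ((1 : ℝ) / 4) ≤ y
  · -- `z = X^{1/4}`
    rw [min_eq_right hcase]
    have hz2 : 2 ≤ X ^ ((1 : ℝ) / 4) := hX4
    have h := prod_one_sub_rootCount_le_mul h2 hle hz2 hcase
    refine h.trans (mul_le_mul_of_nonneg_right (mul_le_mul_of_nonneg_left ?_ (by positivity)) hV0)
    have hlogz : Real.log (X ^ ((1 : ℝ) / 4)) = (1 / 4) * Real.log X := Real.log_rpow hX0 _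
    have hlogz0 : 0 < Real.log (X ^ ((1 : ℝ) / 4)) := Real.log_pos (by linarith)
    rw [Real.rpow_two]
    have hratio : Real.log y / Real.log (X ^ ((1 : ℝ) / 4)) ≤ 4 * Real.log y / (m * Real.log 2) := by
      rw [hlogz, div_le_div_iff₀ (by linarith) hmlog]
      nlinarith
    have hratio0 : 0 ≤ Real.log y / Real.log (X ^ ((1 : ℝ) / 4)) := div_nonneg hlogy.le hlogz0.le
    exact pow_le_pow_left₀ hratio0 hratio 2
  · -- `z = y`
    rw [min_eq_left (not_le.mp hcase).le]
    have ht2 : 1 ≤ (4 * Real.log y / (m * Real.log 2)) ^ 2 := one_le_pow₀ ht1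
    calc V = 1 * 1 * V := by ring
      _ ≤ (2 * Real.exp (17 + 12 / Real.log 2)) * (4 * Real.log y / (m * Real.log 2)) ^ 2 * V :=
          mul_le_mul_of_nonneg_right (mul_le_mul hKω1 ht2 zero_le_one (by positivity)) hV0

/-- **Range IIb** (`N/2^{M+1} < q' ≤ N/16`, `2^M ≤ y⁴`): for `q ≡ 3 (mod 8)`, `q ≤ N`, `y ≥ 2`,
the (5.5)-type input with constant `K_c` on `[q^{9.5}, X₁)`, `2 ≤ q^{9.5}`, `y ≤ q^{9.5} ≤ N/2^{M+1}`,
`M ≥ 3`, `M log 2 ≤ 4 log y`, `N < X₁`: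
`∑_{q'} ∑_r T(q', r) ≤ (1 + Cω) N · 4K_c (3√A + 1) + (e⁸/16) · 1536 K_c N`,
`A = Kω V(y) (4 log y/log 2)²`. [cite: GranvilleMollin2000, §6B (6.2)] -/
theorem sum_rangeIIb_le {d : ℤ} {q N : ℕ} (hdq : d = -(q : ℤ)) (hq8 : q % 8 = 3) (hqN : q ≤ N)
    (hN : 2 ≤ N) {y Kc X₁ : ℝ} (hy : 2 ≤ y) (hKc : 0 ≤ Kc)
    (h55 : ∀ t : ℝ, (q : ℝ) ^ ((19 : ℝ) / 2) ≤ t → t < X₁ →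
      ∑ p ∈ Nat.primesLE ⌊t⌋₊, (polyRootCountMod ![rabinowitschPoly d] p : ℝ) * Real.log p ≤
        Kc * (t * Real.log t))
    (hq95 : 2 ≤ (q : ℝ) ^ ((19 : ℝ) / 2)) (hyq : y ≤ (q : ℝ) ^ ((19 : ℝ) / 2)) {M : ℕ} (hM3 : 3 ≤ M)
    (hMy : (M : ℝ) * Real.log 2 ≤ 4 * Real.log y)
    (hx : (q : ℝ) ^ ((19 : ℝ) / 2) ≤ (N : ℝ) / 2 ^ (M + 1)) (hX₁ : (N : ℝ) < X₁) :
    ∑ q' ∈ (Nat.primesLE ⌊(2 : ℝ) ^ (M - 3) * ((N : ℝ) / 2 ^ (M + 1))⌋₊).filter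
        (fun q' => ⌊(N : ℝ) / 2 ^ (M + 1)⌋₊ < q'),
      ∑ r ∈ (range q').filter (fun r : ℕ => (q' : ℤ) ∣ (rabinowitschPoly d).eval (r : ℤ)),
        (#((apIndex N q' r).filter fun n : ℕ =>
          ((rabinowitschPoly d).eval (n : ℤ)).natAbs.Coprime (primesProdBelow y)) : ℝ) ≤
      (1 + SieveSequence.flConst 2 (2 * Real.exp (17 + 12 / Real.log 2))) * N *
          (4 * Kc * (3 * Real.sqrt ((2 * Real.exp (17 + 12 / Real.log 2)) *
            (∏ p ∈ Nat.primesBelow ⌈y⌉₊, (1 - (polyRootCountMod ![rabinowitschPoly d] p : ℝ) / p)) *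
            (4 * Real.log y / Real.log 2) ^ 2) + 1)) +
        Real.exp 8 / 16 * (1536 * Kc * N) := by
  obtain ⟨h2, hle⟩ := rabinowitsch_omega_hyps hdq hq8
  set Q95 : ℝ := (q : ℝ) ^ ((19 : ℝ) / 2) with hQ95
  set x₃ : ℝ := (N : ℝ) / 2 ^ (M + 1) with hx₃
  set J : ℕ := M - 3 with hJ
  set V := ∏ p ∈ Nat.primesBelow ⌈y⌉₊, (1 - (polyRootCountMod ![rabinowitschPoly d] p : ℝ) / p) with hV
  set Kω : ℝ := 2 * Real.exp (17 + 12 / Real.log 2) with hKω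
  have hV0 : 0 ≤ V := (prod_one_sub_rootCount_pos h2 hle y).le
  have hN0 : (0 : ℝ) < N := by exact_mod_cast (show 0 < N by omega)
  have hx₃2 : 2 ≤ x₃ := hq95.trans hx
  have hx₃1 : 1 ≤ x₃ := by linarith
  have hx₃0 : 0 < x₃ := by linarith
  have hlog2 : 0 < Real.log 2 := Real.log_pos one_lt_two
  have hlogy : 0 < Real.log y := Real.log_pos (by linarith)
  have hJx : (2 : ℝ) ^ J * x₃ = (N : ℝ) / 16 := two_pow_sub_three_mul hM3 N
  have hJN : (2 : ℝ) ^ J * x₃ ≤ N := by rw [hJx]; linarith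
  -- the scale of a block: for `p` in block `j`, `X = N/p ∈ [2^{M-j}, …)`
  have hscale : ∀ j < J, ∀ p ∈ (Nat.primesLE ⌊(2 : ℝ) ^ (j + 1) * x₃⌋₊).filter
      (fun p => ⌊(2 : ℝ) ^ j * x₃⌋₊ < p),
      p.Prime ∧ y ≤ (p : ℝ) ∧ (2 : ℝ) ^ (M - j) ≤ (N : ℝ) / p ∧ 16 ≤ (N : ℝ) / p := by
    intro j hj p hp
    rw [mem_filter, Nat.mem_primesLE] at hp
    have hprime := hp.1.2
    have h2j : 0 < (2 : ℝ) ^ j * x₃ := by positivity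
    have hp_gt : (2 : ℝ) ^ j * x₃ < p := (Nat.floor_lt h2j.le).mp hp.2
    have hp_le : (p : ℝ) ≤ (2 : ℝ) ^ (j + 1) * x₃ :=
      le_trans (by exact_mod_cast hp.1.1) (Nat.floor_le (by positivity))
    have hp0 : (0 : ℝ) < p := by exact_mod_cast hprime.pos
    have hyp : y ≤ p := by
      have : x₃ ≤ (2 : ℝ) ^ j * x₃ := le_mul_of_one_le_left hx₃0.le (one_le_pow₀ (by norm_num))
      linarith [hyq.trans hx]
    have hXge : (2 : ℝ) ^ (M - j) ≤ (N : ℝ) / p := by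
      rw [le_div_iff₀ hp0]
      have hMj : M - j + (j + 1) = M + 1 := by omega
      calc (2 : ℝ) ^ (M - j) * p ≤ (2 : ℝ) ^ (M - j) * ((2 : ℝ) ^ (j + 1) * x₃) :=
            mul_le_mul_of_nonneg_left hp_le (by positivity)
        _ = (2 : ℝ) ^ (M + 1) * x₃ := by rw [← mul_assoc, ← pow_add, hMj]
        _ = N := by rw [hx₃]; field_simp
    have h16 : (16 : ℝ) ≤ (N : ℝ) / p := by
      have h4 : 4 ≤ M - j := by omega
      have : (2 : ℝ) ^ 4 ≤ (2 : ℝ) ^ (M - j) := pow_le_pow_right₀ (by norm_num) h4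
      linarith [show (2 : ℝ) ^ 4 = 16 by norm_num]
    exact ⟨hprime, hyp, hXge, h16⟩
  -- the weight function and its block maxima
  set w : ℕ → ℝ := fun p => ∏ p' ∈ Nat.primesBelow ⌈min y (((N : ℝ) / p) ^ ((1 : ℝ) / 4))⌉₊,
    (1 - (polyRootCountMod ![rabinowitschPoly d] p' : ℝ) / p') with hw
  set W : ℕ → ℝ := fun j => min 1 (Kω * (4 * Real.log y / ((M - j : ℕ) * Real.log 2)) ^ 2 * V) with hW
  have hW0 : ∀ j < J, 0 ≤ W j := fun j _ => le_min zero_le_one (by positivity)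
  have hWle : ∀ j < J, ∀ p ∈ (Nat.primesLE ⌊(2 : ℝ) ^ (j + 1) * x₃⌋₊).filter
      (fun p => ⌊(2 : ℝ) ^ j * x₃⌋₊ < p), w p ≤ W j := by
    intro j hj p hp
    obtain ⟨-, -, hXge, -⟩ := hscale j hj p hp
    exact densityProduct_min_le hdq hq8 hy hMy (by omega) (Nat.sub_le M j) hXge
  -- per-progression bound
  have hper : ∀ q' ∈ (Nat.primesLE ⌊(2 : ℝ) ^ J * x₃⌋₊).filter (fun q' => ⌊x₃⌋₊ < q'),
      ∑ r ∈ (range q').filter (fun r : ℕ => (q' : ℤ) ∣ (rabinowitschPoly d).eval (r : ℤ)),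
        (#((apIndex N q' r).filter fun n : ℕ =>
          ((rabinowitschPoly d).eval (n : ℤ)).natAbs.Coprime (primesProdBelow y)) : ℝ) ≤
        (polyRootCountMod ![rabinowitschPoly d] q' : ℝ) *
          ((1 + SieveSequence.flConst 2 Kω) * ((N : ℝ) / q') * w q' +
            Real.sqrt ((N : ℝ) / q') * Real.log ((N : ℝ) / q') ^ 2 * (Real.exp 8 / 16)) := by
    intro q' hq'
    rw [mem_filter, Nat.mem_primesLE] at hq'
    have hprime := hq'.1.2
    have hq'0 : (0 : ℝ) < q' := by exact_mod_cast hprime.pos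
    have hgt : x₃ < q' := (Nat.floor_lt hx₃0.le).mp hq'.2
    have hyq' : y ≤ q' := by linarith [hyq.trans hx]
    have hq'le : (q' : ℝ) ≤ (N : ℝ) / 16 := by
      rw [← hJx]; exact le_trans (by exact_mod_cast hq'.1.1) (Nat.floor_le (by positivity))
    set X : ℝ := (N : ℝ) / q' with hX
    have h16 : 16 ≤ X := by
      rw [hX, le_div_iff₀ hq'0]; rw [le_div_iff₀ (by norm_num)] at hq'le; linarith
    have hX0 : 0 < X := by linarith
    have hX1 : 1 ≤ X := by linarith
    set z : ℝ := min y (X ^ ((1 : ℝ) / 4)) with hz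
    have hz4 : 2 ≤ X ^ ((1 : ℝ) / 4) := by
      rw [← sixteen_rpow_quarter]; exact Real.rpow_le_rpow (by norm_num) h16 (by norm_num)
    have hz2 : 2 ≤ z := le_min hy hz4
    have hzy : z ≤ y := min_le_left _ _
    have hzX4 : z ≤ X ^ ((1 : ℝ) / 4) := min_le_right _ _
    have hzX : z ≤ Real.sqrt X := by
      refine hzX4.trans ?_
      rw [Real.sqrt_eq_rpow]
      exact Real.rpow_le_rpow_of_exponent_le hX1 (by norm_num)
    have hT := fun r => rabinowitsch_card_apIndex_coprime_le (r := r) hdq hq8 hprime hqN hN hz2 hzy hyq' hzX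
    -- `log² z ≤ log² X / 16`
    have hz0 : 0 < z := by linarith
    have hlogz : Real.log z ≤ Real.log X / 4 := by
      have := Real.log_le_log hz0 hzX4
      rwa [Real.log_rpow hX0, one_div_mul_eq_div] at this
    have hlogz0 : 0 ≤ Real.log z := Real.log_nonneg (by linarith)
    have hlogsq : Real.log z ^ 2 ≤ Real.log X ^ 2 / 16 := by
      have := pow_le_pow_left₀ hlogz0 hlogz 2
      calc Real.log z ^ 2 ≤ (Real.log X / 4) ^ 2 := this
        _ = Real.log X ^ 2 / 16 := by ring
    refine sum_roots_le_mul _ fun r _ => (hT r).trans ?_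
    have hsqrt0 : 0 ≤ Real.sqrt X := Real.sqrt_nonneg X
    have hrem : Real.sqrt X * (Real.exp 8 * Real.log z ^ 2) ≤
        Real.sqrt X * Real.log X ^ 2 * (Real.exp 8 / 16) := by
      calc Real.sqrt X * (Real.exp 8 * Real.log z ^ 2) ≤ Real.sqrt X * (Real.exp 8 * (Real.log X ^ 2 / 16)) :=
            mul_le_mul_of_nonneg_left (mul_le_mul_of_nonneg_left hlogsq (Real.exp_pos 8).le) hsqrt0
        _ = Real.sqrt X * Real.log X ^ 2 * (Real.exp 8 / 16) := by ring
    have hmain : (1 + SieveSequence.flConst 2 Kω) * X *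
        ∏ p ∈ Nat.primesBelow ⌈z⌉₊, (1 - (polyRootCountMod ![rabinowitschPoly d] p : ℝ) / p) =
        (1 + SieveSequence.flConst 2 Kω) * X * w q' := by rw [hw]
    linarith [hmain]
  refine (sum_le_sum hper).trans ?_
  rw [sum_omega_mul_split']
  -- block bounds from the (5.5)-type input
  have hxj : ∀ j < J, Q95 ≤ (2 : ℝ) ^ j * x₃ ∧ 2 ≤ (2 : ℝ) ^ j * x₃ ∧ 2 * ((2 : ℝ) ^ j * x₃) < X₁ := by
    intro j hj
    have h2j : (1 : ℝ) ≤ (2 : ℝ) ^ j := one_le_pow₀ (by norm_num)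
    have h1 : x₃ ≤ (2 : ℝ) ^ j * x₃ := le_mul_of_one_le_left hx₃0.le h2j
    refine ⟨hx.trans h1, hx₃2.trans h1, ?_⟩
    have hj1 : (2 : ℝ) ^ (j + 1) ≤ (2 : ℝ) ^ J := pow_le_pow_right₀ (by norm_num) hj
    calc 2 * ((2 : ℝ) ^ j * x₃) = (2 : ℝ) ^ (j + 1) * x₃ := by ring
      _ ≤ (2 : ℝ) ^ J * x₃ := mul_le_mul_of_nonneg_right hj1 hx₃0.le
      _ ≤ N := hJN
      _ < X₁ := hX₁
  have hblock_div : ∀ j < J, ∑ p ∈ (Nat.primesLE ⌊(2 : ℝ) ^ (j + 1) * x₃⌋₊).filter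
      (fun p => ⌊(2 : ℝ) ^ j * x₃⌋₊ < p), (polyRootCountMod ![rabinowitschPoly d] p : ℝ) / p ≤ 4 * Kc := by
    intro j hj
    obtain ⟨h1, h2', h3⟩ := hxj j hj
    have h := sum_omega_div_block_le_of_chebyshev (d := d) hKc h55 h2' h1 h3
    rwa [show 2 * ((2 : ℝ) ^ j * x₃) = (2 : ℝ) ^ (j + 1) * x₃ by ring] at h
  have hblock : ∀ j < J, ∑ p ∈ (Nat.primesLE ⌊(2 : ℝ) ^ (j + 1) * x₃⌋₊).filter
      (fun p => ⌊(2 : ℝ) ^ j * x₃⌋₊ < p), (polyRootCountMod ![rabinowitschPoly d] p : ℝ) ≤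
        4 * Kc * ((2 : ℝ) ^ j * x₃) := by
    intro j hj
    obtain ⟨h1, h2', h3⟩ := hxj j hj
    have h := sum_omega_block_le_of_chebyshev (d := d) hKc h55 h2' h1 h3
    rwa [show 2 * ((2 : ℝ) ^ j * x₃) = (2 : ℝ) ^ (j + 1) * x₃ by ring] at h
  -- (i) the weighted sum
  have hweight := sum_omega_div_weight_dyadic_le (d := d) hx₃0.le J hblock_div hWle hW0
  -- `∑_{j<J} W j = ∑_{4 ≤ m ≤ M} min(1, A/m²) ≤ 3√A + 1`
  set A : ℝ := Kω * V * (4 * Real.log y / Real.log 2) ^ 2 with hA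
  have hA0 : 0 ≤ A := by positivity
  have hWA : ∀ j ∈ range J, W j = min 1 (A / ((M - j : ℕ) : ℝ) ^ 2) := by
    intro j hj
    rw [mem_range] at hj
    have hm0 : ((M - j : ℕ) : ℝ) ≠ 0 := by
      have : 0 < M - j := by omega
      exact_mod_cast this.ne'
    simp only [hW, hA]
    congr 1
    field_simp
  have hsumW : ∑ j ∈ range J, W j ≤ 3 * Real.sqrt A + 1 := by
    rw [sum_congr rfl hWA]
    have hreindex : ∑ j ∈ range J, min 1 (A / ((M - j : ℕ) : ℝ) ^ 2) =
        ∑ m ∈ Ico 4 (M + 1), min 1 (A / (m : ℝ) ^ 2) := by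
      rw [Finset.sum_Ico_eq_sum_range, show M + 1 - 4 = J by omega]
      rw [← Finset.sum_range_reflect (fun k => min 1 (A / ((4 + k : ℕ) : ℝ) ^ 2)) J]
      refine sum_congr rfl fun j hj => ?_
      rw [mem_range] at hj
      have : M - j = 4 + (J - 1 - j) := by omega
      rw [this]
    rw [hreindex]
    exact sum_min_one_div_sq_le hA0 M
  have hmainsum : ∑ q' ∈ (Nat.primesLE ⌊(2 : ℝ) ^ J * x₃⌋₊).filter (fun q' => ⌊x₃⌋₊ < q'),
      (polyRootCountMod ![rabinowitschPoly d] q' : ℝ) / q' * w q' ≤ 4 * Kc * (3 * Real.sqrt A + 1) :=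
    hweight.trans (mul_le_mul_of_nonneg_left hsumW (by positivity))
  -- (ii) the remainder sum
  have hrem : ∑ q' ∈ (Nat.primesLE ⌊(2 : ℝ) ^ J * x₃⌋₊).filter (fun q' => ⌊x₃⌋₊ < q'),
      (polyRootCountMod ![rabinowitschPoly d] q' : ℝ) *
        (Real.sqrt ((N : ℝ) / q') * Real.log ((N : ℝ) / q') ^ 2) ≤ 1536 * Kc * N := by
    refine (sum_omega_sqrt_logsq_dyadic_le (d := d) hx₃1 (by positivity) J hJN hblock).trans ?_
    have h1 : ((2 : ℝ) ^ J * x₃) ^ ((1 : ℝ) / 4) ≤ (N : ℝ) ^ ((1 : ℝ) / 4) :=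
      Real.rpow_le_rpow (by positivity) hJN (by norm_num)
    have h2' : (N : ℝ) ^ ((3 : ℝ) / 4) * (N : ℝ) ^ ((1 : ℝ) / 4) = N := by
      rw [← Real.rpow_add hN0]; norm_num
    calc 384 * (4 * Kc) * (N : ℝ) ^ ((3 : ℝ) / 4) * ((2 : ℝ) ^ J * x₃) ^ ((1 : ℝ) / 4)
        ≤ 384 * (4 * Kc) * (N : ℝ) ^ ((3 : ℝ) / 4) * (N : ℝ) ^ ((1 : ℝ) / 4) :=
          mul_le_mul_of_nonneg_left h1 (by positivity)
      _ = 1536 * Kc * N := by rw [mul_assoc, h2']; ring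
  -- assemble
  have hC0 : 0 ≤ 1 + SieveSequence.flConst 2 Kω := by
    have := SieveSequence.flConst_pos (κ := 2) (K := Kω) (by norm_num) (by positivity)
    linarith
  exact add_le_add (mul_le_mul_of_nonneg_left hmainsum (by positivity))
    (mul_le_mul_of_nonneg_left hrem (by positivity))

end Literature.Barriers.Parity
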